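import Mathlib
import Summits.KontsevichZagierPeriods.Zeta5Search.SecondOrderRaisePair
import HarnessLib

/-!
# ζ(5) search — the ODD-CENTRE class of a type and functionals of `(η − c)Φ_T` (tools for THEOREM A‴ / `LawA3`)

Cell `pub-zeta5` (HONEST FRAMING: systematic search; no irrationality claim unless certified), typer seat generation 11.
REPORT-gen2-g10 §2.2 (R3): the self-conjugate class containing the ODD centre, with exponent list `T = (L, e)` along its levels, has
class function `(η − L/2)Φ_T` and first-digit functionals `σ = σ₂(T) − (L/2)σ(T) = τ(T)/2`.  Here:
* `wHat_of_rho_mul` / `vHat_of_rho_mul` — if the cofactor data of a level class are `ρ_{i,σ} = (i − c)ρ^T_{i,σ} + ρ^T_{i,σ+1}` then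
  `ŵ = ŵ₂(T) − cŵ(T)` and `v̂ = v̂₂(T) − cv̂(T)` (the bookkeeping shared by all "multiply by `η − c`" situations);
* `centre_level_eq` — for an odd-centre level class `b₀ = 2y + Lp` (so `L` is odd, `odd_L_of_centre`);
* `classRho_centre_level`, `wHat_centre_level`, `vHat_centre_level` — the odd-centre class realises `c = L/2`;
* `not_isRaise_of_centre` — an odd-centre class is never a single raise of a palindromic type (its own list is a palindrome of EVEN
  length), so in `LawA3` the two alternatives for a sub-deep class are exclusive.
Nothing here bears on irrationality.
-/

noncomputable section

open Finset PowerSeries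

namespace Summit.KontsevichZagierPeriods.Zeta5Search.SecondOrder

open Summit.KontsevichZagierPeriods.Zeta5Search.DualSeries (InBox)
open Summit.KontsevichZagierPeriods.Zeta5Search.CasoratianValuation (InPolytope)
open Summit.KontsevichZagierPeriods.Zeta5Search.ClusterValuation
open Summit.KontsevichZagierPeriods.Zeta5Search.LevelClass (typeRho typeW typeV typeExp classSet_level level_injective level_mem
  classPoles_level typeW_congr typeV_congr)
open Literature.NumberTheory.Transcendental.BallRivoal (harm)

variable {p : ℕ} [hp : Fact p.Prime]

/-! ## §1 Functionals of `(η − c)Φ_T` from the cofactor relation -/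

section RhoMul

variable (b : ℕ → ℤ) {x L : ℕ} (hx : x < p) (hL : x + L * p ≤ (b 0).toNat) (hL' : (b 0).toNat < x + L * p + p)
  (e : ℕ → ℤ) (he : ∀ k ≤ L, netExp b (x + k * p) = e k) (c : ℚ)
  (hrho : ∀ i ≤ L, e i < 0 → ∀ σ : ℕ, 1 ≤ σ → (σ : ℤ) ≤ -e i →
    classRho b p (x + i * p) σ = (((i : ℕ) : ℚ) - c) * typeRho L e i σ + (if (σ : ℤ) + 1 ≤ -e i then typeRho L e i (σ + 1) else 0))
include hx hL hL' he hrho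

/-- **`ŵ = ŵ₂(T) − c ŵ(T)`** when the cofactor data are those of `(η − c)Φ_T`. -/
theorem wHat_of_rho_mul : wHat b p x = typeW2 L e - c * typeW L e := by
  have hP : (classSet b p x).filter (fun q => netExp b q < 0) =
      ((range (L + 1)).filter fun k => e k < 0).image fun k => x + k * p := classPoles_level b hx hL hL' e he
  unfold wHat typeW typeW2 classPoles
  rw [hP, sum_image (fun a _ c _ h => level_injective hp.out.pos x h), mul_sum, ← sum_sub_distrib]
  refine sum_congr rfl fun k hk => ?_
  obtain ⟨hkr, hkneg⟩ := mem_filter.1 hk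
  have hkL : k ≤ L := by have := mem_range.1 hkr; omega
  rw [he k hkL]
  by_cases h3 : e k ≤ -3
  · rw [if_pos h3, if_pos h3, if_pos h3, hrho k hkL hkneg 3 (by norm_num) (by push_cast; omega)]
    by_cases h4 : e k ≤ -4
    · rw [if_pos (by push_cast; omega), if_pos h4]; ring
    · rw [if_neg (by push_cast; omega), if_neg h4]; ring
  · rw [if_neg h3, if_neg h3, if_neg h3, if_neg (by omega)]; ring

/-- **`v̂ = v̂₂(T) − c v̂(T)`** when the cofactor data are those of `(η − c)Φ_T`. -/
theorem vHat_of_rho_mul : vHat b p x = typeV2 L e - c * typeV L e := by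
  have hP : (classSet b p x).filter (fun q => netExp b q < 0) =
      ((range (L + 1)).filter fun k => e k < 0).image fun k => x + k * p := classPoles_level b hx hL hL' e he
  unfold vHat typeV typeV2 classPoles
  rw [hP, sum_image (fun a _ c _ h => level_injective hp.out.pos x h), mul_sum, ← sum_sub_distrib]
  refine sum_congr rfl fun k hk => ?_
  obtain ⟨hkr, hkneg⟩ := mem_filter.1 hk
  have hkL : k ≤ L := by have := mem_range.1 hkr; omega
  rw [he k hkL, level_div hx, mul_sum, ← sum_sub_distrib]
  refine sum_congr rfl fun σ hσ => ?_
  have hσ' := mem_Icc.1 hσ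
  rw [hrho k hkL hkneg σ hσ'.1 (by omega)]
  ring

end RhoMul

/-! ## §2 The odd-centre class -/

section Centre

variable (b : ℕ → ℤ) {y L : ℕ} (hy : y < p) (hL : y + L * p ≤ (b 0).toNat) (hL' : (b 0).toNat < y + L * p + p)
  (hodd : ¬ (2 : ℤ) ∣ b 0) (hcen : CentreIn b p y)
include hy hL hL' hcen

omit hp in
/-- **The centre sits at level `L/2`**: `b₀ = 2y + Lp` for a self-conjugate level class. -/
theorem centre_level_eq (h0 : 0 ≤ b 0) : (b 0 : ℤ) = 2 * y + L * p := by
  obtain ⟨t, ht⟩ := hcen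
  have hb0 : (((b 0).toNat : ℕ) : ℤ) = b 0 := Int.toNat_of_nonneg h0
  have h1 : ((y + L * p : ℕ) : ℤ) ≤ (((b 0).toNat : ℕ) : ℤ) := by exact_mod_cast hL
  have h2 : (((b 0).toNat : ℕ) : ℤ) < ((y + L * p + p : ℕ) : ℤ) := by exact_mod_cast hL'
  push_cast at h1 h2
  have hp0 : (0 : ℤ) < p := by exact_mod_cast hp_pos_of_lt hy
  -- `b₀ − 2y − Lp = −p t − … ` is a multiple of `p` in `(−p, p)`
  have hmul : (b 0 : ℤ) - 2 * y - L * p = p * (-t - L) := by linarith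
  have hlt : -(p : ℤ) < (b 0 : ℤ) - 2 * y - L * p := by
    have : (y : ℤ) < p := by exact_mod_cast hy
    linarith
  have hlt' : (b 0 : ℤ) - 2 * y - L * p < p := by linarith
  rw [hmul] at hlt hlt'
  have h3 : -t - (L : ℤ) = 0 := by
    rcases lt_trichotomy (-t - (L : ℤ)) 0 with h | h | h
    · nlinarith
    · exact h
    · nlinarith
  rw [h3, mul_zero] at hmul
  linarith
  where
  /-- `0 < p` from `y < p`. -/
  hp_pos_of_lt {y p : ℕ} (h : y < p) : 0 < p := by omega

include hodd in
omit hp in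
/-- **`L` is odd** for an odd-centre class (`b₀ = 2y + Lp` with `b₀`, `p` odd). -/
theorem odd_L_of_centre (h0 : 0 ≤ b 0) : ¬ 2 ∣ L := by
  have h := centre_level_eq b hy hL hL' hcen h0
  intro hL2
  apply hodd
  obtain ⟨k, hk⟩ := hL2
  rw [h, hk]; push_cast
  exact ⟨(y : ℤ) + k * p, by ring⟩

include hodd in
/-- **The cofactor data of the odd-centre class are those of `(η − L/2)Φ_T`.** -/
theorem classRho_centre_level (hb : InPolytope b) (e : ℕ → ℤ) (he : ∀ k ≤ L, netExp b (y + k * p) = e k) {i : ℕ} (hi : i ≤ L)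
    (hneg : e i < 0) (σ : ℕ) (hσ : (σ : ℤ) ≤ -e i) :
    classRho b p (y + i * p) σ =
      (((i : ℕ) : ℚ) - (L : ℚ) / 2) * typeRho L e i σ + (if (σ : ℤ) + 1 ≤ -e i then typeRho L e i (σ + 1) else 0) := by
  have h0 : 0 ≤ b 0 := hb.1.1
  have hq := level_mem b hy hL hL' hi
  have hp0 : (p : ℚ) ≠ 0 := Nat.cast_ne_zero.2 hp.out.ne_zero
  have hcenq : CentreIn b p (y + i * p) := (centreIn_iff_of_mem hq).2 hcen
  have hctr := centre_level_eq b hy hL hL' hcen h0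
  -- the centre factor is `X + (i − L/2)`
  have hδ : (((y + i * p : ℕ) : ℚ) - ((b 0 : ℤ) : ℚ) / 2) / p = ((i : ℕ) : ℚ) - (L : ℚ) / 2 := by
    have : ((b 0 : ℤ) : ℚ) = 2 * y + L * p := by exact_mod_cast hctr
    rw [this, div_eq_iff hp0]; push_cast; ring
  have hδ0 : (((i : ℕ) : ℚ) - (L : ℚ) / 2) ≠ 0 := by
    intro h
    have hL2 : ¬ 2 ∣ L := odd_L_of_centre b hy hL hL' hodd hcen h0
    apply hL2
    have h2 : (2 * i : ℚ) = L := by linarith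
    exact ⟨i, by exact_mod_cast (show (L : ℚ) = 2 * i by linarith)⟩
  -- the product over the class is the type product
  have hprod : (∏ s ∈ (classSet b p (y + i * p)).erase (y + i * p), binomSeries ((((y + i * p : ℕ) : ℚ) - s) / p) (netExp b s)) =
      typeProd L e i := by
    unfold typeProd
    rw [classSet_eq_of_mem hq, classSet_level b hy hL hL', ← image_erase (level_injective hp.out.pos y),
      prod_image (fun a _ c _ h => level_injective hp.out.pos y h)]
    refine prod_congr rfl fun j hj => ?_
    have hjL : j ≤ L := by have := mem_range.1 (mem_of_mem_erase hj); omega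
    rw [he j hjL]
    congr 1
    rw [div_eq_iff hp0]; push_cast; ring
  unfold classRho
  rw [he i hi, classCofactor, if_pos ⟨hodd, hcenq⟩, hprod, hδ, binomSeries_one hδ0, coeff_mul_X_add_C', ← typeRho_eq]
  congr 1
  by_cases h1 : (σ : ℤ) + 1 ≤ -e i
  · rw [if_pos h1, if_neg (by omega), typeRho_eq, show (-e i).toNat - σ - 1 = (-e i).toNat - (σ + 1) by omega]
  · rw [if_neg h1, if_pos (by omega)]

include hodd in
/-- **`ŵ` of the odd-centre class**: `ŵ_y = ŵ₂(T) − (L/2)ŵ(T)`. -/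
theorem wHat_centre_level (hb : InPolytope b) (e : ℕ → ℤ) (he : ∀ k ≤ L, netExp b (y + k * p) = e k) :
    wHat b p y = typeW2 L e - (L : ℚ) / 2 * typeW L e :=
  wHat_of_rho_mul b hy hL hL' e he _ fun _ hi hneg σ _ hσ => classRho_centre_level b hy hL hL' hodd hcen hb e he hi hneg σ hσ

include hodd in
/-- **`v̂` of the odd-centre class**: `v̂_y = v̂₂(T) − (L/2)v̂(T)`. -/
theorem vHat_centre_level (hb : InPolytope b) (e : ℕ → ℤ) (he : ∀ k ≤ L, netExp b (y + k * p) = e k) :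
    vHat b p y = typeV2 L e - (L : ℚ) / 2 * typeV L e :=
  vHat_of_rho_mul b hy hL hL' e he _ fun _ hi hneg σ _ hσ => classRho_centre_level b hy hL hL' hodd hcen hb e he hi hneg σ hσ

end Centre

/-! ## §3 A palindromic raise of a palindrome has even length difference — no raise for the odd-centre class -/

omit hp in
/-- If `S = (M, f)` is a single raise of the palindrome `T = (L, e)`, and `S` is itself a palindrome with a negative entry, then
`M = L` is even (the raise sits at the middle level `L/2`). -/
theorem even_of_pal_raise {L M : ℕ} {e f : ℕ → ℤ} (hpal : ∀ k ≤ L, e (L - k) = e k) (hfpal : ∀ k ≤ M, f (M - k) = f k)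
    (hneg : ∃ i ≤ M, f i < 0) (h : isRaise ((List.range (L + 1)).map e) ((List.range (M + 1)).map f) = true) : 2 ∣ M := by
  rcases isRaise_level h with ⟨k, hk, hML, hf⟩ | ⟨hML, hf⟩ | ⟨hML, hf⟩
  · subst hML
    have h1 := hfpal k hk
    rw [hf k hk, hf (M - k) (by omega), raiseAt, raiseAt, if_pos rfl, hpal k hk] at h1
    by_cases hkk : M - k = k
    · exact ⟨k, by omega⟩
    · rw [if_neg hkk] at h1; omega
  · -- `1 :: T` palindromic forces `e ≡ 1`: no negative entry
    exfalso
    subst hML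
    have hall : ∀ d ≤ L, e (L - d) = 1 := by
      intro d
      induction d with
      | zero =>
        intro _
        have h1 := hfpal 0 (Nat.zero_le _)
        rw [hf 0 (by omega), hf (L + 1 - 0) (by omega), consOne, consOne, if_pos rfl, if_neg (by omega)] at h1
        simpa using h1
      | succ d ih =>
        intro hd
        have h1 := hfpal (d + 1) (by omega)
        rw [hf (d + 1) (by omega), hf (L + 1 - (d + 1)) (by omega), consOne, consOne, if_neg (by omega),
          if_neg (by omega), Nat.add_sub_cancel] at h1
        -- `e (L - d - 1) = e d`, and `e d = e (L - d) = 1`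
        rw [show L + 1 - (d + 1) - 1 = L - (d + 1) by omega] at h1
        rw [h1, ← hpal d (by omega)]
        exact ih (by omega)
    obtain ⟨i, hi, hfi⟩ := hneg
    rw [hf i hi, consOne] at hfi
    split_ifs at hfi with hi0
    · omega
    · have := hall (L - (i - 1)) (by omega)
      rw [show L - (L - (i - 1)) = i - 1 by omega] at this
      omega
  · exfalso
    subst hML
    have hall : ∀ d ≤ L, e d = 1 := by
      intro d
      induction d with
      | zero =>
        intro _
        have h1 := hfpal (L + 1) le_rfl
        rw [hf (L + 1) le_rfl, hf (L + 1 - (L + 1)) (by omega), snocOne, snocOne, if_pos rfl, Nat.sub_self,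
          if_neg (by omega)] at h1
        exact h1
      | succ d ih =>
        intro hd
        have h1 := hfpal (d + 1) (by omega)
        rw [hf (d + 1) (by omega), hf (L + 1 - (d + 1)) (by omega), snocOne, snocOne, if_neg (by omega),
          if_neg (by omega), show L + 1 - (d + 1) = L - d by omega, hpal d (by omega)] at h1
        rw [← h1]; exact ih (by omega)
    obtain ⟨i, hi, hfi⟩ := hneg
    rw [hf i hi, snocOne] at hfi
    split_ifs at hfi with hi0
    · omega
    · have := hall i (by omega); omega

end Summit.KontsevichZagierPeriods.Zeta5Search.SecondOrder

end
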